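import Summits.Ventures.QEC.Thresholds.PlanarSurfaceCodeSAWThresholdsDual
import Summits.Ventures.QEC.Thresholds.ToricCodePhenomenologicalKernelZ3SymmK12
import Summits.Ventures.QEC.Thresholds.ToricCodePhenomenologicalThresholds
import Literature.InformationTheory.QuantumCodes.PlanarCodeSpaceTimePathsBound
import Literature.InformationTheory.QuantumCodes.CSSPhenomenologicalReindex
import HarnessLib

/-!
# Planar surface codes with NOISY syndrome measurement (`q = p`, polynomially many rounds): the SAW-counting threshold
# `p₀(μ(ℤ³)) > .0112` for every minimum-weight / space-time-MWPM decoder family, both sectors — unconditional, tier CERTIFIED (kernel)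

Venture QEC, `Summits/Ventures/QEC/Thresholds/` (LADDER-QEC rung Q5, PARTITION row 09 "phenomenological"; qec-type-09 gen 6,
cell item 135 «09.PSAW», part (C)). Until now the tree certified the `T`-round memory experiment of the planar surface codes
(`planarPhenomFailureFamily`, lit-2's generic space-time model `CSSPhenom` with `H = planarHX k`, `q = p`) at the
cluster-expansion value `p₀(5) ≈ .0101` (`planar_phenom_isThresholdLowerBound`), while the toric codes stand at the
space-time SAW value `p₀(4.7476) > .0112` (`phenomThreshold_kernelZ3SymmK12`). The Literature files
`PlanarCodeSpaceTime{Lift,Paths,PathsBound}.lean` (this item) prove DKLP's space-time counting bound for the planar code in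
its RELATIVE form (rough-to-rough self-avoiding space-time paths from the `(k+2)·T` bottom rough sites):
`Prob ≤ (k+2)·T·C·r^{k+2}/(1-r)` under `cₙ(ℤ³) ≤ C νⁿ`, `r = 2ν√(p(1-p))`. This file packages the consequences:

| theorem | statement | tier |
|---|---|---|
| `planar_phenom_oddResidual_of_not_corrects`, `planarPhenomFailureFamily_le_of_sawCountBound3` | failure of the memory experiment ⇒ the residual history projects to an odd bottom crossing (one logical qubit); finite-size bound `P_fail(k) ≤ (k+2)·T(k)·C·r^{k+2}/(1-r)` | CERTIFIED (kernel) |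
| `planar_phenom_isThresholdLowerBound_of_sawCountBound3`, `…_of_connectiveConstant_three_le` | `cₙ(ℤ³) ≤ C νⁿ ⇒ p_c ≥ p₀(ν)`; `μ(ℤ³) ≤ μ' ⇒ p_c ≥ p₀(μ')` — every polynomially bounded schedule, every minimum-weight space-time decoder family of the `H_X`-sector | CERTIFIED (kernel), parametric |
| ★ `planar_phenom_isThresholdLowerBound_kernelZ3SymmK12`, `planar_phenom_accuracyThreshold_gt_0112`, `planar_phenom_accuracyThreshold_stMinWeight_gt_0112`, `planar_phenom_decaysExponentially_0112` | **`p_c^phenom(planar) > .0112`** at the kernel certificate `μ(ℤ³) ≤ 4.7476` (was `.0101`), every polynomially bounded schedule and minimum-weight space-time decoder family; exponential decay for `p ≤ .0112` | CERTIFIED (kernel), unconditional |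
| `planar_phenom_mwpm_isThresholdLowerBound_kernelZ3SymmK12`, `planar_phenom_mwpm_accuracyThreshold_gt_0112` | the same for EVERY space-time boundary-MWPM family (defects = syndrome changes matched in the space-time graph with the rough edge as boundary) | CERTIFIED (kernel), unconditional |
| `planarHZ_eq_reindex_planarHX`, `planarPhenomFailureFamily'_eq_pullback`, `planar_phenom_isThresholdLowerBound'_kernelZ3SymmK12`, `planar_phenom_accuracyThreshold'_gt_0112`, `planar_phenom_mwpm_isThresholdLowerBound'_kernelZ3SymmK12` | SECOND SECTOR (`H_Z` record, smooth edges) by the coordinate-swap self-duality + space-time pull-back (`CSSPhenom.phenomFailureProb_pullback`): **`p_c > .0112`** | CERTIFIED (kernel), unconditional |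

HONEST FRAMING. Certified LOWER bounds, one error type at a time (sector-wise min-weight space-time decoding, `q = p`); decimals
are kernel consequences of the memory-12 certificate `μ(ℤ³) ≤ 4.7476` (`SAW.Zd.FiniteMemory3.connectiveConstant_three_le_47476`).
NOT asserted: DKLP's printed `p, q < .0114` (numerical `μ₃`, CLAIM) and the numerical MWPM value `p_{c0} = .0293 ± .0002`
(Wang–Harrington–Preskill 2003, abstract) — certified `.0112` vs numerical `.0293`. No `native_decide`, no named fact.

## References

* [DennisEtAl2002] E. Dennis, A. Kitaev, A. Landahl, J. Preskill, *Topological quantum memory*, J. Math. Phys. 43 (2002)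
  4452–4505, arXiv:quant-ph/0110143, §4.2–4.3 (space-time lattice, syndrome = boundary), §5.1 (E_min on the space-time
  lattice), §5.2–5.3 (eqs. (e_ineq), (saw_L), (saw_3), (threshold_iso), (fail_iso), (threshold_iso_num); planar codes).
* [WangHarringtonPreskill2003] C. Wang, J. Harrington, J. Preskill, Ann. Phys. 303 (2003) 31–58, arXiv:quant-ph/0207088,
  abstract (`p_{c0} = .0293 ± .0002` for the 3D random-plaquette gauge model, numerical).
* [PonitzTittmann2000] Electron. J. Combin. 7 (2000) R21, Table 2 (`d = 3, k = 12`); [LinPryadko2024] PRA 109 (2024) 022407, §4.2 Thm 6.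
-/

noncomputable section

namespace Summit.Ventures.QEC.Thresholds

open Filter Topology Finset Matrix
open Literature.InformationTheory.QuantumCodes
open Literature.InformationTheory.QuantumCodes.PlanarCode
open Literature.InformationTheory.QuantumCodes.ToricCode (SAWCountBound3 IsPolyBounded)
open Literature.Probability.RandomPlanarGeometry

/-! ### Failure leaves an odd-crossing residual; the finite-size bound -/

/-- **Failure of the memory experiment ⇒ odd-crossing residual.** If a minimum-weight space-time decoder `D` of the
`T`-round experiment of the `H_X`-sector fails on the history `E` (the net residual `Π(D(∂E) + E)` is a NON-TRIVIAL
logical), the projection of the residual crosses the bottom rough boundary an odd number of times (`Π` of a space-time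
cycle is undetectable, `CSSPhenom.mulVec_proj_eq_zero`; one encoded qubit, `planar_bottomCrossing_eq_one`).
[cite: DennisEtAl2002, §4.3 (success iff the residual is homologically trivial) and §6.1 (the projection Π)] -/
theorem planar_phenom_oddResidual_of_not_corrects (k T : ℕ) {D : CSSPhenom.STDecoder (PlanarCheck k) (PlanarQubit k) T}
    (hD : D.IsMinWeight (CSSPhenom.stSyn (planarHX k) T) (CSSPhenom.stCycles (planarHX k) T) hammingNorm)
    {E : CSSPhenom.History (PlanarCheck k) (PlanarQubit k) T}
    (hfail : ¬ D.Corrects (CSSPhenom.stSyn (planarHX k) T)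
      (CSSPhenom.stTrivial (planarSZ k : Set (PlanarQubit k → ZMod 2)) T) E) :
    ∑ b : Fin (k + 2), CSSPhenom.proj (D (CSSPhenom.stSyn (planarHX k) T E) + E) (Sum.inl (0, b)) = 1 := by
  have hc : CSSPhenom.stMatrix (planarHX k) T *ᵥ (D (CSSPhenom.stSyn (planarHX k) T E) + E) = 0 := hD.add_mem E
  exact planar_bottomCrossing_eq_one k (CSSPhenom.mulVec_proj_eq_zero hc) hfail

open Classical in
/-- The failure probability of the memory experiment is at most the probability of an odd-crossing residual.
[cite: DennisEtAl2002, §5.2 (Prob_fail ≤ the probability of a non-trivial (relative) space-time polygon)] -/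
theorem planarPhenomFailureFamily_le_sum_oddResidual (T : ℕ → ℕ)
    (D : ∀ k, CSSPhenom.STDecoder (PlanarCheck k) (PlanarQubit k) (T k))
    (hD : ∀ k, (D k).IsMinWeight (CSSPhenom.stSyn (planarHX k) (T k)) (CSSPhenom.stCycles (planarHX k) (T k)) hammingNorm)
    (k : ℕ) {p : ℝ} (hp0 : 0 ≤ p) (hp1 : p ≤ 1) :
    planarPhenomFailureFamily T D k p ≤
      ∑ E ∈ univ.filter (fun E : CSSPhenom.History (PlanarCheck k) (PlanarQubit k) (T k) =>
        ∑ b : Fin (k + 2), CSSPhenom.proj (D k (CSSPhenom.stSyn (planarHX k) (T k) E) + E) (Sum.inl (0, b)) = 1),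
        phenomenologicalWeight (T k) p p (supp E) := by
  refine Finset.sum_le_sum_of_subset_of_nonneg (fun E hE => ?_) fun E _ _ => ?_
  · rw [Finset.mem_filter] at hE ⊢
    exact ⟨Finset.mem_univ _, planar_phenom_oddResidual_of_not_corrects k (T k) (hD k) hE.2⟩
  · rw [ToricCode.phenomenologicalWeight_self]
    exact bernoulliWeight_nonneg hp0 hp1 _

/-- ★ **DKLP's finite-size bound for the planar memory experiment, proved**: under `cₙ(ℤ³) ≤ C νⁿ` (`ν > 0`), for every
minimum-weight space-time decoder family of the `H_X`-sector, every `0 ≤ p ≤ 1/2` (`q = p`) with `r = 2ν√(p(1-p)) < 1`: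
`P_fail(k) ≤ (k+2)·T(k)·C·r^{k+2}/(1-r)` (relative form of eq. (fail_iso), our constants).
[cite: DennisEtAl2002, §5.3 eq. (fail_iso)] -/
theorem planarPhenomFailureFamily_le_of_sawCountBound3 {C ν : ℝ} (hν : 0 < ν) (hC : SAWCountBound3 C ν) (T : ℕ → ℕ)
    (D : ∀ k, CSSPhenom.STDecoder (PlanarCheck k) (PlanarQubit k) (T k))
    (hD : ∀ k, (D k).IsMinWeight (CSSPhenom.stSyn (planarHX k) (T k)) (CSSPhenom.stCycles (planarHX k) (T k)) hammingNorm)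
    (k : ℕ) {p : ℝ} (hp0 : 0 ≤ p) (hp : p ≤ 1 / 2) (hr1 : 2 * ν * Real.sqrt (p * (1 - p)) < 1) :
    planarPhenomFailureFamily T D k p ≤ ((k : ℝ) + 2) * (T k) * C * (2 * ν * Real.sqrt (p * (1 - p))) ^ (k + 2) /
      (1 - 2 * ν * Real.sqrt (p * (1 - p))) :=
  (planarPhenomFailureFamily_le_sum_oddResidual T D hD k hp0 (by linarith)).trans
    (st_sum_oddResidual_le hν hC (hD k) hp0 hp hr1)

/-- **Below threshold for `4ν² p(1-p) < 1`** (given `cₙ(ℤ³) ≤ C νⁿ`, `ν > 0`, polynomially many rounds): the planar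
memory-experiment failure probability tends to `0`, for every minimum-weight space-time decoder family of the `H_X`-sector.
[cite: DennisEtAl2002, §5.3 eq. (threshold_iso)] -/
theorem planar_phenom_belowThreshold_of_sawCountBound3 {C ν : ℝ} (hν : 0 < ν) (hC : SAWCountBound3 C ν) {T : ℕ → ℕ}
    (hT : IsPolyBounded T) (D : ∀ k, CSSPhenom.STDecoder (PlanarCheck k) (PlanarQubit k) (T k))
    (hD : ∀ k, (D k).IsMinWeight (CSSPhenom.stSyn (planarHX k) (T k)) (CSSPhenom.stCycles (planarHX k) (T k)) hammingNorm)
    {p : ℝ} (hp0 : 0 ≤ p) (hp : p ≤ 1 / 2) (h4 : 4 * ν ^ 2 * (p * (1 - p)) < 1) :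
    BelowThreshold (planarPhenomFailureFamily T D) p := by
  have ht := st_tendsto_sum_oddResidual hν hC hT D hD hp0 hp h4
  refine squeeze_zero' (Filter.Eventually.of_forall fun k => ?_)
    (Filter.Eventually.of_forall fun k => planarPhenomFailureFamily_le_sum_oddResidual T D hD k hp0 (by linarith)) ht
  refine Finset.sum_nonneg fun E _ => ?_
  rw [ToricCode.phenomenologicalWeight_self]
  exact bernoulliWeight_nonneg hp0 (by linarith) _

/-! ### `p₀(ν)`, `p₀(μ')`, and the kernel certificate `μ(ℤ³) ≤ 4.7476`: `p_c^phenom(planar) > .0112` -/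

/-- **Planar phenomenological threshold `≥ p₀(ν)` from `cₙ(ℤ³) ≤ C νⁿ`** (`ν ≥ 1`), every polynomially bounded schedule and
minimum-weight space-time decoder family of the `H_X`-sector. [cite: DennisEtAl2002, §5.3 eqs. (threshold_iso), (threshold_iso_num)] -/
theorem planar_phenom_isThresholdLowerBound_of_sawCountBound3 {C ν : ℝ} (hν : 1 ≤ ν) (hC : SAWCountBound3 C ν)
    {T : ℕ → ℕ} (hT : IsPolyBounded T) (D : ∀ k, CSSPhenom.STDecoder (PlanarCheck k) (PlanarQubit k) (T k))
    (hD : ∀ k, (D k).IsMinWeight (CSSPhenom.stSyn (planarHX k) (T k)) (CSSPhenom.stCycles (planarHX k) (T k)) hammingNorm) :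
    IsThresholdLowerBound (planarPhenomFailureFamily T D) (thresholdValue ν) := by
  intro p hp₀ hpp
  have hp : p ≤ 1 / 2 := hpp.le.trans (thresholdValue_le_half ν)
  have hlt : p * (1 - p) < thresholdValue ν * (1 - thresholdValue ν) :=
    mul_one_sub_lt_mul_one_sub hpp (by linarith [thresholdValue_le_half ν])
  have hν0 : 0 < ν := lt_of_lt_of_le one_pos hν
  have h4 : 4 * ν ^ 2 * (p * (1 - p)) < 1 := by
    calc 4 * ν ^ 2 * (p * (1 - p)) < 4 * ν ^ 2 * (thresholdValue ν * (1 - thresholdValue ν)) := by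
          gcongr
      _ = 1 := four_mul_sq_mul_thresholdValue hν
  exact planar_phenom_belowThreshold_of_sawCountBound3 hν0 hC hT D hD hp₀ hp h4

/-- **Planar phenomenological threshold from any bound on `μ(ℤ³)`** (tier = that of the bound): if `μ(ℤ³) ≤ μ'`, `μ' ≥ 1`,
then `p₀(μ')` is a threshold lower bound (every polynomially bounded schedule, every minimum-weight space-time decoder
family of the `H_X`-sector). [cite: DennisEtAl2002, §5.3 eqs. (saw_3), (threshold_iso)] -/
theorem planar_phenom_isThresholdLowerBound_of_connectiveConstant_three_le {μ' : ℝ} (hμ'1 : 1 ≤ μ')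
    (hμ : SAW.Zd.connectiveConstant 3 ≤ μ') {T : ℕ → ℕ} (hT : IsPolyBounded T)
    (D : ∀ k, CSSPhenom.STDecoder (PlanarCheck k) (PlanarQubit k) (T k))
    (hD : ∀ k, (D k).IsMinWeight (CSSPhenom.stSyn (planarHX k) (T k)) (CSSPhenom.stCycles (planarHX k) (T k)) hammingNorm) :
    IsThresholdLowerBound (planarPhenomFailureFamily T D) (thresholdValue μ') := by
  refine isThresholdLowerBound_thresholdValue_of_forall_gt hμ'1 fun ν hν p hp0 hp h4 => ?_
  obtain ⟨C, hC⟩ := exists_sawCountBound3_of_connectiveConstant_lt (lt_of_le_of_lt hμ hν)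
  exact planar_phenom_belowThreshold_of_sawCountBound3 (by linarith) hC hT D hD hp0 hp h4

/-- ★ **Planar phenomenological threshold `≥ p₀(4.7476)`, UNCONDITIONAL, tier CERTIFIED (kernel)**: every polynomially
bounded schedule of rounds, every minimum-weight space-time decoder family of the `H_X`-sector (`q = p`), from the
kernel-checked symmetry-reduced memory-12 bound `μ(ℤ³) ≤ 4.7476`.
[cite: DennisEtAl2002, §5.3 eqs. (saw_3), (threshold_iso_num)] [cite: PonitzTittmann2000, Table 2 (d = 3, k = 12)] -/
theorem planar_phenom_isThresholdLowerBound_kernelZ3SymmK12 {T : ℕ → ℕ} (hT : IsPolyBounded T)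
    (D : ∀ k, CSSPhenom.STDecoder (PlanarCheck k) (PlanarQubit k) (T k))
    (hD : ∀ k, (D k).IsMinWeight (CSSPhenom.stSyn (planarHX k) (T k)) (CSSPhenom.stCycles (planarHX k) (T k)) hammingNorm) :
    IsThresholdLowerBound (planarPhenomFailureFamily T D) (thresholdValue 4.7476) :=
  planar_phenom_isThresholdLowerBound_of_connectiveConstant_three_le (by norm_num)
    SAW.Zd.FiniteMemory3.connectiveConstant_three_le_47476 hT D hD

/-- ★ **`p_c^phenom(planar) > .0112`** (`q = p`, polynomially many rounds, every minimum-weight space-time decoder family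
of the `H_X`-sector) — UNCONDITIONAL, tier CERTIFIED (kernel); was `.0101`. DKLP's printed `.0114` and the numerical `.0293`
(Wang–Harrington–Preskill) are CLAIMS, not asserted. [cite: DennisEtAl2002, §5.3 eq. (threshold_iso_num)]
[cite: WangHarringtonPreskill2003, abstract (p_c0 = .0293 ± .0002, numerical)] -/
theorem planar_phenom_accuracyThreshold_gt_0112 {T : ℕ → ℕ} (hT : IsPolyBounded T)
    (D : ∀ k, CSSPhenom.STDecoder (PlanarCheck k) (PlanarQubit k) (T k))
    (hD : ∀ k, (D k).IsMinWeight (CSSPhenom.stSyn (planarHX k) (T k)) (CSSPhenom.stCycles (planarHX k) (T k)) hammingNorm) :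
    (0.0112 : ℝ) < accuracyThreshold (planarPhenomFailureFamily T D) :=
  lt_of_lt_of_le thresholdValue_47476_bounds.1
    (le_accuracyThreshold (planar_phenom_isThresholdLowerBound_kernelZ3SymmK12 hT D hD)
      ((thresholdValue_le_half _).trans (by norm_num)))

/-- The canonical instance: MINIMUM-WEIGHT SPACE-TIME DECODING of the planar memory experiment has `p_c > .0112` —
UNCONDITIONAL, tier CERTIFIED (kernel). [cite: DennisEtAl2002, §5.1 eq. (E_min) and §5.3] -/
theorem planar_phenom_accuracyThreshold_stMinWeight_gt_0112 {T : ℕ → ℕ} (hT : IsPolyBounded T) :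
    (0.0112 : ℝ) < accuracyThreshold (planarPhenomFailureFamily T fun k =>
      Decoder.minWeight (CSSPhenom.stSyn (planarHX k) (T k)) hammingNorm) :=
  planar_phenom_accuracyThreshold_gt_0112 hT _ fun k =>
    Decoder.isMinWeight_minWeight _ _ _
      (fun y z h => by
        show CSSPhenom.stMatrix (planarHX k) (T k) *ᵥ (y - z) = 0
        have h' : CSSPhenom.stMatrix (planarHX k) (T k) *ᵥ y = CSSPhenom.stMatrix (planarHX k) (T k) *ᵥ z := h
        rw [Matrix.mulVec_sub, h', sub_self])
      fun x => by rw [show -x = x from funext fun i => ZMod.neg_eq_self_mod_two (x i)]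

/-- **Exponential decay below `p₀(ν)`** (given `cₙ(ℤ³) ≤ C νⁿ`, `ν ≥ 1`, polynomially many rounds): for every
minimum-weight space-time decoder family of the `H_X`-sector and every `0 ≤ p < p₀(ν)` (`q = p`), `P_fail(k) ≤ C' r'^k` for
some `C'`, `r' < 1` (from `(k+2)·T(k)·C·r^{k+2}/(1-r) ≤ (2AC r²/(1-r))·(k+1)^{m+1}·r^k` when `T(k) ≤ A (k+1)^m`).
[cite: DennisEtAl2002, §5.3 eq. (fail_iso) and the sentence after it] -/
theorem planar_phenom_decaysExponentially_of_sawCountBound3 {C ν : ℝ} (hν : 1 ≤ ν) (hC : SAWCountBound3 C ν)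
    {T : ℕ → ℕ} (hT : IsPolyBounded T) (D : ∀ k, CSSPhenom.STDecoder (PlanarCheck k) (PlanarQubit k) (T k))
    (hD : ∀ k, (D k).IsMinWeight (CSSPhenom.stSyn (planarHX k) (T k)) (CSSPhenom.stCycles (planarHX k) (T k)) hammingNorm)
    {p : ℝ} (hp₀ : 0 ≤ p) (hpp : p < thresholdValue ν) : DecaysExponentially (planarPhenomFailureFamily T D) p := by
  have hp : p ≤ 1 / 2 := hpp.le.trans (thresholdValue_le_half ν)
  have hlt : p * (1 - p) < thresholdValue ν * (1 - thresholdValue ν) :=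
    mul_one_sub_lt_mul_one_sub hpp (by linarith [thresholdValue_le_half ν])
  have hν0 : 0 < ν := lt_of_lt_of_le one_pos hν
  have h4 : 4 * ν ^ 2 * (p * (1 - p)) < 1 := by
    calc 4 * ν ^ 2 * (p * (1 - p)) < 4 * ν ^ 2 * (thresholdValue ν * (1 - thresholdValue ν)) := by
          gcongr
      _ = 1 := four_mul_sq_mul_thresholdValue hν
  set s := Real.sqrt (p * (1 - p)) with hs
  set r := 2 * ν * s with hr
  have hpp' : 0 ≤ p * (1 - p) := mul_nonneg hp₀ (by linarith)
  have hr0 : 0 ≤ r := by rw [hr]; positivity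
  have hr1 : r < 1 := by
    have hsq : r ^ 2 = 4 * ν ^ 2 * (p * (1 - p)) := by
      rw [hr, mul_pow, mul_pow, hs, Real.sq_sqrt hpp']; ring
    have h' : r ^ 2 < 1 := by rw [hsq]; exact h4
    have := (sq_lt_one_iff_abs_lt_one r).1 h'
    rwa [abs_of_nonneg hr0] at this
  have h1r : 0 < 1 - r := by linarith
  have hC0 : 0 ≤ C := by
    have h0 := hC 0
    rw [SAW.Zd.count_zero, pow_zero, mul_one, Nat.cast_one] at h0
    linarith
  obtain ⟨A, m, hA⟩ := hT
  refine decaysExponentially_of_eventually_abs_le (A := 2 * A * C * r ^ 2 / (1 - r)) (k := m + 1) hr0 hr1 ?_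
  refine Filter.Eventually.of_forall fun k => ?_
  have hnonneg : 0 ≤ planarPhenomFailureFamily T D k p := by
    refine Finset.sum_nonneg fun E _ => ?_
    rw [ToricCode.phenomenologicalWeight_self]
    exact bernoulliWeight_nonneg hp₀ (by linarith) _
  rw [abs_of_nonneg hnonneg]
  have hb := planarPhenomFailureFamily_le_of_sawCountBound3 hν0 hC T D hD k hp₀ hp hr1
  have hk : (0 : ℝ) ≤ (k : ℝ) + 2 := by positivity
  have hk2 : (k : ℝ) + 2 ≤ 2 * ((k : ℝ) + 1) := by linarith [(Nat.cast_nonneg k : (0 : ℝ) ≤ k)]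
  have hX : 0 ≤ A * ((k : ℝ) + 1) ^ m * C * r ^ (k + 2) / (1 - r) := by
    have hA0 : 0 ≤ A * ((k : ℝ) + 1) ^ m := (Nat.cast_nonneg (T k)).trans (hA k)
    positivity
  calc planarPhenomFailureFamily T D k p
      ≤ ((k : ℝ) + 2) * (T k) * C * r ^ (k + 2) / (1 - r) := hb
    _ ≤ ((k : ℝ) + 2) * (A * ((k : ℝ) + 1) ^ m) * C * r ^ (k + 2) / (1 - r) :=
        div_le_div_of_nonneg_right
          (mul_le_mul_of_nonneg_right (mul_le_mul_of_nonneg_right (mul_le_mul_of_nonneg_left (hA k) hk) hC0)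
            (pow_nonneg hr0 _)) h1r.le
    _ = ((k : ℝ) + 2) * (A * ((k : ℝ) + 1) ^ m * C * r ^ (k + 2) / (1 - r)) := by ring
    _ ≤ 2 * ((k : ℝ) + 1) * (A * ((k : ℝ) + 1) ^ m * C * r ^ (k + 2) / (1 - r)) :=
        mul_le_mul_of_nonneg_right hk2 hX
    _ = 2 * A * C * r ^ 2 / (1 - r) * ((k : ℝ) + 1) ^ (m + 1) * r ^ k := by
        rw [pow_succ, pow_add]
        ring

/-- **Exponential decay at every `0 ≤ p ≤ .0112`** for the planar memory experiment (`q = p`, polynomially many rounds,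
every minimum-weight space-time decoder family of the `H_X`-sector) — UNCONDITIONAL, tier CERTIFIED (kernel) (cubic
walk-count constant at `ν = 4.75 > μ(ℤ³)`; `.0112 < p₀(4.75)`). [cite: DennisEtAl2002, §5.3 eq. (fail_iso)] -/
theorem planar_phenom_decaysExponentially_0112 {T : ℕ → ℕ} (hT : IsPolyBounded T)
    (D : ∀ k, CSSPhenom.STDecoder (PlanarCheck k) (PlanarQubit k) (T k))
    (hD : ∀ k, (D k).IsMinWeight (CSSPhenom.stSyn (planarHX k) (T k)) (CSSPhenom.stCycles (planarHX k) (T k)) hammingNorm)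
    {p : ℝ} (hp₀ : 0 ≤ p) (hpp : p ≤ 0.0112) : DecaysExponentially (planarPhenomFailureFamily T D) p := by
  have hlt : SAW.Zd.connectiveConstant 3 < 4.75 :=
    lt_of_le_of_lt SAW.Zd.FiniteMemory3.connectiveConstant_three_le_47476 (by norm_num)
  obtain ⟨C, hC⟩ := exists_sawCountBound3_of_connectiveConstant_lt hlt
  have hval : (0.0112 : ℝ) < thresholdValue 4.75 := by
    unfold thresholdValue
    have : Real.sqrt (1 - 1 / (4.75 : ℝ) ^ 2) < 0.9776 := by
      rw [Real.sqrt_lt' (by norm_num)]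
      norm_num
    linarith
  exact planar_phenom_decaysExponentially_of_sawCountBound3 (by norm_num) hC hT D hD hp₀ (lt_of_le_of_lt hpp hval)

/-! ### Space-time minimum-weight perfect matching with the rough edge as boundary -/

/-- ★ **Planar phenomenological threshold `≥ p₀(4.7476)` for EVERY space-time boundary-MWPM decoder family** (defects =
syndrome changes of the `T(k)` rounds matched in the space-time graph with the boundary check; any presentation `ι` of
`planarHX k` as graphlike-with-boundary, any link metric on the space-time lift, tie-break, geodesics) — UNCONDITIONAL, tier
CERTIFIED (kernel). [cite: DennisEtAl2002, §5.1 (E_min on the space-time lattice by matching) and §5.3] -/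
theorem planar_phenom_mwpm_isThresholdLowerBound_kernelZ3SymmK12 {T : ℕ → ℕ} (hT : IsPolyBounded T)
    {ι : ∀ k, PlanarQubit k → Sym2 (Option (PlanarCheck k))} (hι : ∀ k, IsGraphlikeVia (planarHX k) (ι k))
    (m : ∀ k, EdgeMetric (stEndsOf (ι k) (T k)))
    {D' : ∀ k, Decoder (Option (PlanarCheck k × Fin (T k + 1)) → ZMod 2)
      (HistoryLoc (PlanarQubit k) (PlanarCheck k) (T k) → ZMod 2)}
    (hD : ∀ k, IsMatchingDecoder (m k) (D' k)) :
    IsThresholdLowerBound (planarPhenomFailureFamily T fun k => boundaryDecoder (D' k)) (thresholdValue 4.7476) :=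
  planar_phenom_isThresholdLowerBound_kernelZ3SymmK12 hT _ fun k => isMinWeight_boundaryDecoder_st (hι k) (T k) (hD k)

/-- **`p_c^{MWPM, phenom}(planar) > .0112`**, every space-time boundary-MWPM family — UNCONDITIONAL, tier CERTIFIED (kernel);
was `.0101`. [cite: DennisEtAl2002, §5.1 and §5.3 eq. (threshold_iso_num)] -/
theorem planar_phenom_mwpm_accuracyThreshold_gt_0112 {T : ℕ → ℕ} (hT : IsPolyBounded T)
    {ι : ∀ k, PlanarQubit k → Sym2 (Option (PlanarCheck k))} (hι : ∀ k, IsGraphlikeVia (planarHX k) (ι k))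
    (m : ∀ k, EdgeMetric (stEndsOf (ι k) (T k)))
    {D' : ∀ k, Decoder (Option (PlanarCheck k × Fin (T k + 1)) → ZMod 2)
      (HistoryLoc (PlanarQubit k) (PlanarCheck k) (T k) → ZMod 2)}
    (hD : ∀ k, IsMatchingDecoder (m k) (D' k)) :
    (0.0112 : ℝ) < accuracyThreshold (planarPhenomFailureFamily T fun k => boundaryDecoder (D' k)) :=
  planar_phenom_accuracyThreshold_gt_0112 hT _ fun k => isMinWeight_boundaryDecoder_st (hι k) (T k) (hD k)

/-! ### The second sector (`H_Z` record, smooth edges as boundary) by the coordinate-swap self-duality -/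

/-- **`H_Z = H_X` re-indexed by the coordinate swaps** of the planar self-duality (`planarHGPCode_swap_eq_reindex`).
[cite: TillichZemor2014, §3 (the surface code as HGP(H, Hᵀ))] -/
theorem planarHZ_eq_reindex_planarHX (k : ℕ) :
    planarHZ k = Matrix.reindex (planarCheckSwap k) (planarQubitSwap k) (planarHX k) := by
  change (planarHGPCode k).swap.HX = _
  rw [planarHGPCode_swap_eq_reindex, CSSCode.reindex_HX]
  rfl

/-- The `X`-stabilizers are the `Z`-stabilizers transported along the self-duality: `x ∈ rs H_X ↔ x ∘ swap ∈ rs H_Z`.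
[cite: TillichZemor2014, §3] [cite: LinPryadko2024, §4.2 Thm 6] -/
theorem planar_mem_planarSX_iff_comp_mem (k : ℕ) (x : PlanarQubit k → ZMod 2) :
    x ∈ (planarSX k : Set (PlanarQubit k → ZMod 2)) ↔
      x ∘ ⇑(planarQubitSwap k) ∈ (planarSZ k : Set (PlanarQubit k → ZMod 2)) := by
  change x ∈ (planarHGPCode k).swap.rowSpZ ↔ x ∘ ⇑(planarQubitSwap k) ∈ ((planarHGPCode k).rowSpZ : Set _)
  rw [planarHGPCode_swap_eq_reindex]
  exact CSSCode.mem_rowSpZ_reindex_iff _ _ _ _ x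

/-- The **space-time pull-back** of an `H_Z`-record decoder to an `H_X`-record decoder along the self-duality.
[cite: LinPryadko2024, §4.2 Thm 6 (permutation-equivalent codes)] -/
def planarSTPullback (k T : ℕ) (D' : CSSPhenom.STDecoder (PlanarZCheck k) (PlanarQubit k) T) :
    CSSPhenom.STDecoder (PlanarCheck k) (PlanarQubit k) T :=
  fun s => D' (s ∘ ⇑((planarCheckSwap k).prodCongr (Equiv.refl (Fin (T + 1)))).symm) ∘
    ⇑(Equiv.sumCongr ((planarQubitSwap k).prodCongr (Equiv.refl (Fin T)))
      ((planarCheckSwap k).prodCongr (Equiv.refl (Fin T))))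

/-- **The `H_Z`-sector memory-experiment failure probability of `D'` IS the `H_X`-sector one of its space-time pull-back**
(every `k`, `T`, `p`, `q`). [cite: LinPryadko2024, §4.2 Thm 6] [cite: DennisEtAl2002, §4.1–4.2 (the same problem on the dual lattice)] -/
theorem planar_xPhenomFailureProb_eq_pullback (k T : ℕ) (D' : CSSPhenom.STDecoder (PlanarZCheck k) (PlanarQubit k) T)
    (p q : ℝ) :
    CSSPhenom.phenomFailureProb (planarHZ k) T (planarSX k : Set (PlanarQubit k → ZMod 2)) D' p q =
      CSSPhenom.phenomFailureProb (planarHX k) T (planarSZ k : Set (PlanarQubit k → ZMod 2)) (planarSTPullback k T D')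
        p q := by
  rw [planarHZ_eq_reindex_planarHX]
  exact CSSPhenom.phenomFailureProb_pullback (planarHX k) _ _ T (SX := (planarSZ k : Set (PlanarQubit k → ZMod 2)))
    (planar_mem_planarSX_iff_comp_mem k) D' p q

/-- **The space-time pull-back of a minimum-weight decoder is minimum-weight.** [cite: LinPryadko2024, §4.2 Thm 6] -/
theorem planarSTPullback_isMinWeight (k T : ℕ) {D' : CSSPhenom.STDecoder (PlanarZCheck k) (PlanarQubit k) T}
    (hD' : D'.IsMinWeight (CSSPhenom.stSyn (planarHZ k) T) (CSSPhenom.stCycles (planarHZ k) T) hammingNorm) :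
    (planarSTPullback k T D').IsMinWeight (CSSPhenom.stSyn (planarHX k) T) (CSSPhenom.stCycles (planarHX k) T)
      hammingNorm := by
  rw [planarHZ_eq_reindex_planarHX] at hD'
  exact CSSPhenom.isMinWeight_pullback (planarHX k) _ _ hD'

/-- **Family form**: the `H_Z`-sector phenomenological family decoded by `D'` IS the `H_X`-sector family of the pull-backs.
[cite: DennisEtAl2002, §4.1 and §5.3 (p = q)] -/
theorem planarPhenomFailureFamily'_eq_pullback (T : ℕ → ℕ)
    (D' : ∀ k, CSSPhenom.STDecoder (PlanarZCheck k) (PlanarQubit k) (T k)) :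
    planarPhenomFailureFamily' T D' = planarPhenomFailureFamily T fun k => planarSTPullback k (T k) (D' k) := by
  funext k p
  exact planar_xPhenomFailureProb_eq_pullback k (T k) (D' k) p p

/-- **Transfer principle**: an `H_X`-sector phenomenological threshold bound valid for EVERY minimum-weight space-time
decoder family (schedule `T`) holds for every minimum-weight space-time decoder family of the `H_Z`-record.
[cite: DennisEtAl2002, §4.1 (X and Z errors treated separately — identically, by duality)] -/
theorem planar_phenom_isThresholdLowerBound'_of_unprimed {T : ℕ → ℕ} {p₀ : ℝ}
    (h : ∀ D : ∀ k, CSSPhenom.STDecoder (PlanarCheck k) (PlanarQubit k) (T k),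
      (∀ k, (D k).IsMinWeight (CSSPhenom.stSyn (planarHX k) (T k)) (CSSPhenom.stCycles (planarHX k) (T k)) hammingNorm) →
        IsThresholdLowerBound (planarPhenomFailureFamily T D) p₀)
    (D' : ∀ k, CSSPhenom.STDecoder (PlanarZCheck k) (PlanarQubit k) (T k))
    (hD' : ∀ k, (D' k).IsMinWeight (CSSPhenom.stSyn (planarHZ k) (T k)) (CSSPhenom.stCycles (planarHZ k) (T k))
      hammingNorm) :
    IsThresholdLowerBound (planarPhenomFailureFamily' T D') p₀ := by
  rw [planarPhenomFailureFamily'_eq_pullback]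
  exact h _ fun k => planarSTPullback_isMinWeight k (T k) (hD' k)

/-- ★ **Second sector: planar phenomenological threshold `≥ p₀(4.7476)`** (`H_Z` record, every polynomially bounded
schedule, every minimum-weight space-time decoder family) — UNCONDITIONAL, tier CERTIFIED (kernel).
[cite: DennisEtAl2002, §4.1 and §5.3 eq. (threshold_iso_num)] -/
theorem planar_phenom_isThresholdLowerBound'_kernelZ3SymmK12 {T : ℕ → ℕ} (hT : IsPolyBounded T)
    (D' : ∀ k, CSSPhenom.STDecoder (PlanarZCheck k) (PlanarQubit k) (T k))
    (hD' : ∀ k, (D' k).IsMinWeight (CSSPhenom.stSyn (planarHZ k) (T k)) (CSSPhenom.stCycles (planarHZ k) (T k))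
      hammingNorm) :
    IsThresholdLowerBound (planarPhenomFailureFamily' T D') (thresholdValue 4.7476) :=
  planar_phenom_isThresholdLowerBound'_of_unprimed (planar_phenom_isThresholdLowerBound_kernelZ3SymmK12 hT) D' hD'

/-- **`p_c^phenom > .0112` for the `H_Z` record** of the planar surface codes — UNCONDITIONAL, tier CERTIFIED (kernel).
[cite: DennisEtAl2002, §4.1 and §5.3 eq. (threshold_iso_num)] -/
theorem planar_phenom_accuracyThreshold'_gt_0112 {T : ℕ → ℕ} (hT : IsPolyBounded T)
    (D' : ∀ k, CSSPhenom.STDecoder (PlanarZCheck k) (PlanarQubit k) (T k))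
    (hD' : ∀ k, (D' k).IsMinWeight (CSSPhenom.stSyn (planarHZ k) (T k)) (CSSPhenom.stCycles (planarHZ k) (T k))
      hammingNorm) :
    (0.0112 : ℝ) < accuracyThreshold (planarPhenomFailureFamily' T D') :=
  lt_of_lt_of_le thresholdValue_47476_bounds.1
    (le_accuracyThreshold (planar_phenom_isThresholdLowerBound'_kernelZ3SymmK12 hT D' hD')
      ((thresholdValue_le_half _).trans (by norm_num)))

/-- **Second sector, space-time boundary MWPM** (smooth edge as boundary): threshold `≥ p₀(4.7476)` — UNCONDITIONAL, tier
CERTIFIED (kernel). [cite: DennisEtAl2002, §5.1 and §5.3] -/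
theorem planar_phenom_mwpm_isThresholdLowerBound'_kernelZ3SymmK12 {T : ℕ → ℕ} (hT : IsPolyBounded T)
    {ι : ∀ k, PlanarQubit k → Sym2 (Option (PlanarZCheck k))} (hι : ∀ k, IsGraphlikeVia (planarHZ k) (ι k))
    (m : ∀ k, EdgeMetric (stEndsOf (ι k) (T k)))
    {D' : ∀ k, Decoder (Option (PlanarZCheck k × Fin (T k + 1)) → ZMod 2)
      (HistoryLoc (PlanarQubit k) (PlanarZCheck k) (T k) → ZMod 2)}
    (hD : ∀ k, IsMatchingDecoder (m k) (D' k)) :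
    IsThresholdLowerBound (planarPhenomFailureFamily' T fun k => boundaryDecoder (D' k)) (thresholdValue 4.7476) :=
  planar_phenom_isThresholdLowerBound'_kernelZ3SymmK12 hT _ fun k => isMinWeight_boundaryDecoder_st (hι k) (T k) (hD k)

/-- **Both records at once**: below `p₀(4.7476)` (in particular for every `p < .0112`) every pair of minimum-weight
space-time decoder families (one per sector) of the planar memory experiment has BOTH logical failure probabilities `→ 0`.
[cite: DennisEtAl2002, §4.1 and §5.3] -/
theorem planar_phenom_bothSectors_belowThreshold_0112 {T : ℕ → ℕ} (hT : IsPolyBounded T)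
    (DZ : ∀ k, CSSPhenom.STDecoder (PlanarCheck k) (PlanarQubit k) (T k))
    (hDZ : ∀ k, (DZ k).IsMinWeight (CSSPhenom.stSyn (planarHX k) (T k)) (CSSPhenom.stCycles (planarHX k) (T k))
      hammingNorm)
    (DX : ∀ k, CSSPhenom.STDecoder (PlanarZCheck k) (PlanarQubit k) (T k))
    (hDX : ∀ k, (DX k).IsMinWeight (CSSPhenom.stSyn (planarHZ k) (T k)) (CSSPhenom.stCycles (planarHZ k) (T k))
      hammingNorm)
    {p : ℝ} (hp₀ : 0 ≤ p) (hpp : p < 0.0112) :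
    BelowThreshold (planarPhenomFailureFamily T DZ) p ∧ BelowThreshold (planarPhenomFailureFamily' T DX) p :=
  ⟨(planar_phenom_isThresholdLowerBound_kernelZ3SymmK12 hT DZ hDZ).anti thresholdValue_47476_bounds.1.le p hp₀ hpp,
    (planar_phenom_isThresholdLowerBound'_kernelZ3SymmK12 hT DX hDX).anti thresholdValue_47476_bounds.1.le p hp₀ hpp⟩

end Summit.Ventures.QEC.Thresholds
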